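import Mathlib

/-!
# The Shapiro sign of the flat tangent line and the mod-`𝔭²` product law
(algebraic core of PROPOSITION S, solo-informed s45)

In the cell programme (FINDING_S, s45) the flat level-one `ℤ/49`-deformations of the
base-changed Ribet representation `ρ̄_F` over an `e = 1` cell form a torsor
`{ρ^{(t)} : t ∈ 𝔽₇}` under the one-dimensional flat tangent space `𝔽₇ η_H` (THEOREM H);
the lower-left class of `ρ^{(t)}` in the unit plane `U = O_F^× ⊗ 𝔽₇` is `κ₀ + t • c`, where
`κ₀` is the Kummer class of the *other* Ribet lattice and `c = pr(η_H)` spans the tangent line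
`H`.  None of the seven points is reducible (FINDING_M (B1)+(B3)), i.e. `κ₀ + t • c ≠ 0` for all
`t`; `U` is the direct sum of the two `σ`-eigenlines, `κ₀` lies in one of them (which is
one-dimensional) and `c` is an eigenvector.  The purely linear-algebraic conclusion — `c` lies in
the *other* eigenline — is `mem_eigenspace_of_forall_add_smul_ne_zero` below.

The second group of lemmas is the `2 × 2` identity behind the mod-`𝔭²` PRODUCT LAW
(FINDING_S §4, prediction P73, confirmed by job j274892 at 531 primes with no exception):
for a matrix congruent to a unipotent upper-triangular matrix modulo `p` over a ring in which
`p · p = 0` (e.g. `ℤ/p²`), the product of the off-diagonal entries equals `trace − 1 − det`;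
applied to `ρ_Λ(Frob_p) mod 𝔭²` with `tr = a_p`, `det = p` this reads
`7 · c₀(Frob_p) κ₀(Frob_p) ≡ a_p − 1 − p (mod 𝔭²)`.

* `ne_zero_of_forall_add_smul_ne_zero`, `not_mem_span_singleton_of_forall_add_smul_ne_zero` :
  the torsor step;
* `eq_span_singleton_of_finrank_eq_one` : a non-zero vector of a line spans it;
* `mem_eigenspace_of_forall_add_smul_ne_zero` : the eigenline conclusion (PROPOSITION S (S2));
* `smul_eq_iff_eq_inv_smul` : the sign in the twisted-invariants rule
  `Res H¹(G_ℚ, μ_p ⊗ ψ) = U[ψ⁻¹]` (FINDING_S, rule (K)), as bare linear algebra;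
* `lowerLeft_mul_upperRight`, `lowerLeft_mul_upperRight_of_diag`, `productLaw_of_mul_self_eq_zero` :
  the product law.

No number theory is formalised here.
-/

namespace Summit.Langlands.Langlands.Theorems

open Module

section Torsor

variable {K V : Type*} [Field K] [AddCommGroup V] [Module K V]

/-- If no point of the affine line `{κ + t • c : t ∈ K}` is zero, then `κ ≠ 0` (take `t = 0`). -/
theorem ne_zero_of_forall_add_smul_ne_zero {κ c : V} (h : ∀ t : K, κ + t • c ≠ 0) : κ ≠ 0 := by
  simpa using h 0

/-- If no point of the affine line `{κ + t • c : t ∈ K}` is zero and `c ≠ 0`, then `c` is not a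
multiple of `κ`: otherwise `c = μ • κ` with `μ ≠ 0` and `t = -μ⁻¹` gives `κ + t • c = 0`. -/
theorem not_mem_span_singleton_of_forall_add_smul_ne_zero {κ c : V} (hc : c ≠ 0)
    (h : ∀ t : K, κ + t • c ≠ 0) : c ∉ K ∙ κ := by
  intro hmem
  obtain ⟨μ, rfl⟩ := Submodule.mem_span_singleton.mp hmem
  by_cases hμ : μ = 0
  · exact hc (by simp [hμ])
  · have h0 : κ + (-μ⁻¹) • (μ • κ) = 0 := by
      rw [smul_smul, neg_mul, inv_mul_cancel₀ hμ, neg_smul, one_smul, add_neg_cancel]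
    exact h _ h0

/-- A non-zero vector of a one-dimensional submodule spans it. -/
theorem eq_span_singleton_of_finrank_eq_one {W : Submodule K V} [FiniteDimensional K W]
    (hW : finrank K W = 1) {κ : V} (hκW : κ ∈ W) (hκ : κ ≠ 0) : W = K ∙ κ := by
  apply le_antisymm
  · intro w hw
    have hz : (⟨κ, hκW⟩ : W) ≠ 0 := by
      intro h0
      exact hκ (by simpa using congrArg Subtype.val h0)
    obtain ⟨a, ha⟩ := (finrank_eq_one_iff_of_nonzero' (⟨κ, hκW⟩ : W) hz).mp hW ⟨w, hw⟩
    exact Submodule.mem_span_singleton.mpr ⟨a, by simpa using congrArg Subtype.val ha⟩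
  · exact (Submodule.span_singleton_le_iff_mem _ _).mpr hκW

/-- PROPOSITION S (S2), linear-algebra skeleton.  Let `f` be an endomorphism (the action of a
generator `σ` of `Gal(F/ℚ)` on the unit plane), `κ` a vector of the one-dimensional eigenspace for
`a` (the Kummer class `κ₀` of the second Ribet lattice), and `c ≠ 0` an eigenvector for `a` or for
`b` (the lower-left projection of the flat tangent class, spanning the eigenline `H`).  If no point
`κ + t • c` of the Ribet torsor vanishes, then `c` is an eigenvector for `b` and not for `a`:
the tangent line is the eigenline *other* than that of `κ₀`. -/
theorem mem_eigenspace_of_forall_add_smul_ne_zero [FiniteDimensional K V] (f : Module.End K V)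
    {a b : K} {κ c : V} (ha : finrank K (f.eigenspace a) = 1) (hκa : κ ∈ f.eigenspace a)
    (hc : c ≠ 0) (hcab : c ∈ f.eigenspace a ∨ c ∈ f.eigenspace b)
    (h : ∀ t : K, κ + t • c ≠ 0) : c ∈ f.eigenspace b ∧ c ∉ f.eigenspace a := by
  have hκ : κ ≠ 0 := ne_zero_of_forall_add_smul_ne_zero h
  have hspan : f.eigenspace a = K ∙ κ := eq_span_singleton_of_finrank_eq_one ha hκa hκ
  have hnot : c ∉ f.eigenspace a := by
    rw [hspan]
    exact not_mem_span_singleton_of_forall_add_smul_ne_zero hc h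
  exact ⟨hcab.resolve_left hnot, hnot⟩

/-- Under the hypotheses of `mem_eigenspace_of_forall_add_smul_ne_zero` the two eigenvalues are
distinct: `b ≠ a`. -/
theorem eigenvalue_ne_of_forall_add_smul_ne_zero [FiniteDimensional K V] (f : Module.End K V)
    {a b : K} {κ c : V} (ha : finrank K (f.eigenspace a) = 1) (hκa : κ ∈ f.eigenspace a)
    (hc : c ≠ 0) (hcab : c ∈ f.eigenspace a ∨ c ∈ f.eigenspace b)
    (h : ∀ t : K, κ + t • c ≠ 0) : b ≠ a := by
  rintro rfl
  have := mem_eigenspace_of_forall_add_smul_ne_zero f ha hκa hc hcab h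
  exact this.2 this.1

/-- The sign in the twisted-invariants rule (FINDING_S, rule (K)): for a unit scalar `ψ`, the
condition `ψ • y = x` ("`x` is a `ψ`-twisted invariant with `y = σ • x`") says `y = ψ⁻¹ • x`
(the eigenvalue of `σ` on `x` is `ψ⁻¹`, not `ψ`). -/
theorem smul_eq_iff_eq_inv_smul {ψ : K} (hψ : ψ ≠ 0) (x y : V) : ψ • y = x ↔ y = ψ⁻¹ • x := by
  constructor
  · rintro rfl
    rw [smul_smul, inv_mul_cancel₀ hψ, one_smul]
  · rintro rfl
    rw [smul_smul, mul_inv_cancel₀ hψ, one_smul]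

end Torsor

section ProductLaw

variable {R : Type*} [CommRing R]

/-- The `2 × 2` identity behind the mod-`𝔭²` product law: for any matrix `M = (a, b; c, d)`,
`c · b = tr M − 1 − det M + (a − 1)(d − 1)`. -/
theorem lowerLeft_mul_upperRight (M : Matrix (Fin 2) (Fin 2) R) :
    M 1 0 * M 0 1 = M.trace - 1 - M.det + (M 0 0 - 1) * (M 1 1 - 1) := by
  rw [Matrix.trace_fin_two, Matrix.det_fin_two]
  ring

/-- If `(a − 1)(d − 1) = 0` (e.g. both diagonal entries are `≡ 1` modulo an element of square
zero), the product of the off-diagonal entries is `tr M − 1 − det M`. -/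
theorem lowerLeft_mul_upperRight_of_diag (M : Matrix (Fin 2) (Fin 2) R)
    (h : (M 0 0 - 1) * (M 1 1 - 1) = 0) : M 1 0 * M 0 1 = M.trace - 1 - M.det := by
  rw [lowerLeft_mul_upperRight, h, add_zero]

/-- THE PRODUCT LAW (FINDING_S §4).  Over a ring in which `p · p = 0` (e.g. `ℤ/p²ℤ`), a matrix
whose diagonal entries are `1 + p x` and `1 + p y` — a lift of a unipotent upper-triangular matrix,
such as `ρ_Λ(Frob_ℓ) mod 𝔭²` at a prime `ℓ ≡ 1 (mod p)` split in `F` — satisfies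
`(lower-left) · (upper-right) = tr − 1 − det`.  With `tr = a_ℓ(g)` and `det = ℓ` this is
`7 κ(Frob_ℓ) · c₀(Frob_ℓ) ≡ a_ℓ − 1 − ℓ (mod 𝔭²)`. -/
theorem productLaw_of_mul_self_eq_zero {p : R} (hp : p * p = 0) (M : Matrix (Fin 2) (Fin 2) R)
    (x y : R) (ha : M 0 0 = 1 + p * x) (hd : M 1 1 = 1 + p * y) :
    M 1 0 * M 0 1 = M.trace - 1 - M.det := by
  apply lowerLeft_mul_upperRight_of_diag
  rw [ha, hd]
  calc (1 + p * x - 1) * (1 + p * y - 1) = p * p * (x * y) := by ring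
    _ = 0 := by rw [hp, zero_mul]

/-- The instance used in the programme: `p = 7` in `ℤ/49ℤ`. -/
theorem productLaw_zmod49 (M : Matrix (Fin 2) (Fin 2) (ZMod 49)) (x y : ZMod 49)
    (ha : M 0 0 = 1 + 7 * x) (hd : M 1 1 = 1 + 7 * y) :
    M 1 0 * M 0 1 = M.trace - 1 - M.det :=
  productLaw_of_mul_self_eq_zero (by decide) M x y ha hd

end ProductLaw

end Summit.Langlands.Langlands.Theorems
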